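import Mathlib
import HarnessLib

/-!
# The antipodal inequality for chain-nonnegative submodular kernels on a poset

Helper file for crux `stmt-CriticalPhenomena-4575` (`NoHeavyLowerTail`), new-inequality factory seat
`prim-ineq-gen-1` (gen 2).  Everything here is PROVED.  It generalizes
`PercNearOneGluingNoHeavyLowerTailAntipodalStrongHarris.lean` (the sunflower poset `B < Cᵢ < A` with the
Gladkov kernel) to an ARBITRARY preorder `Q` and an arbitrary kernel `κ : Q → Q → R` satisfying

* (chain nonnegativity)  `x ≤ y → 0 ≤ κ x y`,
* (submodularity on comparable rectangles)  `a₀ ≤ a₁ → b₀ ≤ b₁ → κ a₁ b₁ + κ a₀ b₀ ≤ κ a₁ b₀ + κ a₀ b₁`.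

**Theorem.**  For maps `g h : Finset α → Q` that are monotone (`X ⊆ Y → g X ≤ g Y`, same for `h`) and
nested (`g X ≤ h X`), and every finite `S`,  `0 ≤ Σ_{X ⊆ S} κ (g X) (h (S ∖ X))`.

Proof: induction on `S`; splitting off `a`, the sum is `C(g, h(·∪a)) + C(g(·∪a), h)`, which by
submodularity applied pointwise is `≥ C(g,h) + C(g(·∪a), h(·∪a)) ≥ 0`.

**Use (the "K_Q cone" of valid quadratic rows).**  Let `λ : {0,1}^E → Q` be monotone (e.g. `Q` = the
lattice of set partitions of the terminals ordered by coarsening, `λ(ω)` = the partition into open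
clusters — more open edges give a coarser partition) and `μ` a product measure on `{0,1}^E` with law
`m = λ_* μ` on `Q`.  Conditioning two independent samples on the set `F` of coordinates where both are
`1` and the set `S` where they differ, the pair is `(λ(F ∪ X), λ(F ∪ (S ∖ X)))` with `X ⊆ S` uniform, and
`X ↦ λ(F ∪ X)` is monotone; hence `Σ_{x,y} κ(x,y) m_x m_y = E[κ(λ ω₁, λ ω₂)] ≥ 0`.  Every kernel of the
polyhedral cone `K_Q` cut out by the two displayed conditions is therefore a VALID quadratic row for all
such laws (Harris' inequality and Gladkov's strong Harris inequality are the pull-backs of the simplest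
members).  This file proves the combinatorial core; the measure-theoretic averaging is routine.
-/

namespace Summit.CriticalPhenomena.PercolationContinuityZ3.Theorems

namespace AntipodalSubmodularKernel

open Finset

variable {α : Type*} [DecidableEq α] {Q : Type*} {R : Type*}

/-- Splitting off one coordinate: `C_{S ∪ {a}}(g,h) = C_S(g, h(· ∪ {a})) + C_S(g(· ∪ {a}), h)`. -/
theorem antipodalSum_insert [AddCommMonoid R] (κ : Q → Q → R) {S : Finset α} {a : α} (ha : a ∉ S)
    (g h : Finset α → Q) :
    ∑ X ∈ (insert a S).powerset, κ (g X) (h (insert a S \ X)) =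
      ∑ X ∈ S.powerset, κ (g X) (h (insert a (S \ X))) +
        ∑ X ∈ S.powerset, κ (g (insert a X)) (h (S \ X)) := by
  rw [sum_powerset_insert ha]
  congr 1
  · refine sum_congr rfl fun X hX => ?_
    have haX : a ∉ X := fun h' => ha (mem_powerset.mp hX h')
    rw [insert_sdiff_of_notMem S haX]
  · refine sum_congr rfl fun X hX => ?_
    congr 2
    ext x
    simp only [mem_sdiff, mem_insert]
    constructor
    · rintro ⟨h1 | h1, h2⟩
      · exact (h2 (Or.inl h1)).elim
      · exact ⟨h1, fun hx => h2 (Or.inr hx)⟩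
    · rintro ⟨h1, h2⟩
      refine ⟨Or.inr h1, ?_⟩
      rintro (rfl | hx)
      · exact ha h1
      · exact h2 hx

/-- **Antipodal inequality for chain-nonnegative submodular kernels.**  If `κ x y ≥ 0` for `x ≤ y` and
`κ a₁ b₁ + κ a₀ b₀ ≤ κ a₁ b₀ + κ a₀ b₁` for `a₀ ≤ a₁, b₀ ≤ b₁`, then for monotone nested
`g ≤ h : Finset α → Q` and every finite `S`: `0 ≤ Σ_{X ⊆ S} κ (g X) (h (S ∖ X))`.
[new; the case `Q = {B < Cᵢ < A}` with Gladkov's kernel is `AntipodalStrongHarris.antipodalSum_nonneg`] -/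
theorem antipodalSum_nonneg [Preorder Q] [AddCommGroup R] [PartialOrder R] [IsOrderedAddMonoid R]
    (κ : Q → Q → R) (hpos : ∀ x y : Q, x ≤ y → 0 ≤ κ x y)
    (hsub : ∀ a₀ a₁ b₀ b₁ : Q, a₀ ≤ a₁ → b₀ ≤ b₁ → κ a₁ b₁ + κ a₀ b₀ ≤ κ a₁ b₀ + κ a₀ b₁)
    (S : Finset α) :
    ∀ g h : Finset α → Q, (∀ ⦃X Y : Finset α⦄, X ⊆ Y → g X ≤ g Y) →
      (∀ ⦃X Y : Finset α⦄, X ⊆ Y → h X ≤ h Y) → (∀ X, g X ≤ h X) →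
        0 ≤ ∑ X ∈ S.powerset, κ (g X) (h (S \ X)) := by
  induction S using Finset.induction_on with
  | empty =>
    intro g h _ _ hgh
    simp only [powerset_empty, sum_singleton, sdiff_self]
    exact hpos _ _ (hgh ∅)
  | insert a S ha ih =>
    intro g h hg hh hgh
    rw [antipodalSum_insert κ ha]
    have key : ∑ X ∈ S.powerset, κ (g X) (h (S \ X)) +
        ∑ X ∈ S.powerset, κ (g (insert a X)) (h (insert a (S \ X))) ≤
        ∑ X ∈ S.powerset, κ (g X) (h (insert a (S \ X))) +
          ∑ X ∈ S.powerset, κ (g (insert a X)) (h (S \ X)) := by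
      rw [← sum_add_distrib, ← sum_add_distrib]
      refine sum_le_sum fun X _ => ?_
      have h1 : g X ≤ g (insert a X) := hg (subset_insert a X)
      have h2 : h (S \ X) ≤ h (insert a (S \ X)) := hh (subset_insert a _)
      have := hsub _ _ _ _ h1 h2
      -- κ g₁ h₁ + κ g₀ h₀ ≤ κ g₁ h₀ + κ g₀ h₁
      rw [add_comm (κ (g X) (h (insert a (S \ X))))]
      rw [add_comm (κ (g X) (h (S \ X)))]
      exact this
    have ih₀ := ih g h hg hh hgh
    have ih₁ := ih (fun X => g (insert a X)) (fun X => h (insert a X))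
      (fun _ _ hXY => hg (insert_subset_insert a hXY)) (fun _ _ hXY => hh (insert_subset_insert a hXY))
      fun X => hgh (insert a X)
    have hsum : 0 ≤ ∑ X ∈ S.powerset, κ (g X) (h (S \ X)) +
        ∑ X ∈ S.powerset, κ (g (insert a X)) (h (insert a (S \ X))) := add_nonneg ih₀ ih₁
    exact le_trans hsum key

/-- The diagonal case `g = h = f`: `0 ≤ Σ_{X ⊆ S} κ (f X) (f (S ∖ X))` for every monotone `f`. -/
theorem antipodalSum_self_nonneg [Preorder Q] [AddCommGroup R] [PartialOrder R]
    [IsOrderedAddMonoid R] (κ : Q → Q → R) (hpos : ∀ x y : Q, x ≤ y → 0 ≤ κ x y)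
    (hsub : ∀ a₀ a₁ b₀ b₁ : Q, a₀ ≤ a₁ → b₀ ≤ b₁ → κ a₁ b₁ + κ a₀ b₀ ≤ κ a₁ b₀ + κ a₀ b₁)
    (S : Finset α) (f : Finset α → Q) (hf : ∀ ⦃X Y : Finset α⦄, X ⊆ Y → f X ≤ f Y) :
    0 ≤ ∑ X ∈ S.powerset, κ (f X) (f (S \ X)) :=
  antipodalSum_nonneg κ hpos hsub S f f hf hf fun X => le_refl (f X)

end AntipodalSubmodularKernel

end Summit.CriticalPhenomena.PercolationContinuityZ3.Theorems
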